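import Literature.Probability.Percolation.ConstrainedClusters
import HarnessLib

/-!
# The Gandolfi–Grimmett–Russo / Aizenman–Kesten–Newman counting for BOND percolation
# (Cerf 2015, §3, bond version)

Topic `Literature/Probability/Percolation`. Deterministic (configuration-wise) part of the
counting argument behind the two-arms estimate of

* R. Cerf, *A lower bound on the two-arms exponent for critical percolation on the lattice*,
  Ann. Probab. 43 (2015) 2458–2480, arXiv:1306.3105, §3 ("The proof of Gandolfi, Grimmett and
  Russo"), written there for SITE percolation,

transposed to BOND percolation on a locally finite graph `G` — the form needed for Proposition 1
of Duminil-Copin–Kozma–Tassion 2020 (arXiv:1902.03207, §7: "the arguments of [Cerf] can be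
adapted"; the original Aizenman–Kesten–Newman 1987 / Gandolfi–Grimmett–Russo 1988 argument is for
bond percolation). Fix finite vertex sets `Λ ⊆ L` and a configuration `ω`; clusters are those of
the configuration restricted to the steps inside `L` (`openClusterIn (withinGraph G L)`), and
`𝒞 = bigClusters` is the collection of clusters meeting both `Λ` and `∂ⁱⁿL` (Cerf §2). In the bond
setting the role of Cerf's sites of `Λ(n)` is played by the EDGES of `G` inside `Λ`
(`edgesIn G Λ`):

* `F` = open edges inside `Λ` whose cluster reaches `∂ⁱⁿL`; `G` = closed edges inside `Λ` with an
  endpoint whose cluster reaches `∂ⁱⁿL`; `H` = edges inside `Λ` whose two endpoints lie in two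
  DISTINCT clusters of `𝒞` (the "two-arms edges"; they are closed);
* `touchIn Λ C` = edges inside `Λ` with an endpoint in `C` (Cerf's `C̄ ∩ Λ(n)`).

Since an edge touches at most the two clusters of its endpoints, Cerf's inequality
`|H| ≤ Σ_{C ∈ 𝒞} |∂ᵒᵘᵗC ∩ Λ| − |G|` becomes an IDENTITY here:
`Σ_{C ∈ 𝒞} #{closed e ∈ touchIn Λ C} = |G| + |H|` (`sum_card_touchIn_closed`), while
`Σ_{C ∈ 𝒞} #{open e ∈ touchIn Λ C} = |F|` (`sum_card_touchIn_open`); hence, with Cerf's statistic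
`h(A) = #closed(A)/(1−p) − #open(A)/p`,
**`|H| = (1−p) Σ_{C ∈ 𝒞} h(touchIn Λ C) + ((1−p)/p)|F| − |G|`** (`card_H_eq`). Also
`Σ_{C ∈ 𝒞} |touchIn Λ C| ≤ 2 |edgesIn G Λ|` (Cerf: "a site belongs to at most `2d` sets `C̄`") and
`|𝒞| ≤ |∂ⁱⁿL|` (Cerf §5: "different clusters of `𝒞` intersect `∂ⁱⁿΛ` at different sites").
The expectation identity `E|G| = ((1−p)/p) E|F|` and the central inequality (§5) are in the sequel.

## References

* R. Cerf, Ann. Probab. 43 (2015), §§2–3, §5 (arXiv:1306.3105, pp. 5–6, 8–9) [Cerf2015].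
* M. Aizenman, H. Kesten, C. M. Newman, Comm. Math. Phys. 111 (1987) 505–531; A. Gandolfi,
  G. Grimmett, L. Russo, Comm. Math. Phys. 114 (1988) 549–552 (the bond-percolation original).
* H. Duminil-Copin, G. Kozma, V. Tassion, arXiv:1902.03207, Proposition 1 and §7
  [DuminilcopinKozmaTassion2020].
-/

noncomputable section

namespace Literature.Probability.Percolation

namespace AKN

open LatticeModels Finset
open scoped Classical

variable {V : Type*} [DecidableEq V] (G : SimpleGraph V) [G.LocallyFinite]

/-! ## Clusters inside `L`, the collection `𝒞`, the edge sets `F`, `G`, `H` -/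

/-- The cluster of `x` for the configuration restricted to the steps of `G` inside `L` **reaches the
inner boundary of `L`**. (Cerf 2015, §2: the clusters "which intersect `∂ⁱⁿΛ(n+ℓ)`".)
[cite: Cerf2015, §2] -/
def Reaches (L : Finset V) (ω : BondConfig V) (x : V) : Prop :=
  ∃ w ∈ innerBoundary G L, w ∈ openClusterIn (withinGraph G ↑L) ω x

/-- The cluster of `x` inside `L`, as a finite set of vertices of `L`. [cite: Cerf2015, §2] -/
def clus (L : Finset V) (ω : BondConfig V) (x : V) : Finset V :=
  L.filter fun y => y ∈ openClusterIn (withinGraph G ↑L) ω x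

/-- **The collection `𝒞`**: the clusters (inside `L`) of the vertices of `Λ` whose cluster reaches
`∂ⁱⁿL` — i.e. the clusters of the restricted configuration meeting both `Λ` and `∂ⁱⁿL`
(Cerf 2015, §2, display defining `𝒞`). [cite: Cerf2015, §2] -/
def bigClusters (L Λ : Finset V) (ω : BondConfig V) : Finset (Finset V) :=
  (Λ.filter fun x => Reaches G L ω x).image fun x => clus G L ω x

/-- The edges of `G` inside `Λ` with an endpoint in `C` (the bond analogue of Cerf's `C̄ ∩ Λ(n)`,
§3). [cite: Cerf2015, §3] -/
def touchIn (Λ : Finset V) (C : Finset V) : Finset (Sym2 V) :=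
  (edgesIn G Λ).filter fun e => ∃ v ∈ C, v ∈ e

/-- **`F`**: the open edges inside `Λ` with an endpoint whose cluster reaches `∂ⁱⁿL` (bond analogue of
Cerf's `F = ⋃_{C ∈ 𝒞} C ∩ Λ(n)`, §3). [cite: Cerf2015, §3] -/
def Fset (L Λ : Finset V) (ω : BondConfig V) : Finset (Sym2 V) :=
  (edgesIn G Λ).filter fun e => e ∈ ω ∧ ∃ v, v ∈ e ∧ Reaches G L ω v

/-- **`G`**: the closed edges inside `Λ` with an endpoint whose cluster reaches `∂ⁱⁿL` (bond analogue
of Cerf's `G = ⋃_{C ∈ 𝒞} ∂ᵒᵘᵗC ∩ Λ(n)`, §3). [cite: Cerf2015, §3] -/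
def Gset (L Λ : Finset V) (ω : BondConfig V) : Finset (Sym2 V) :=
  (edgesIn G Λ).filter fun e => e ∉ ω ∧ ∃ v, v ∈ e ∧ Reaches G L ω v

/-- **`H`**: the edges inside `Λ` whose endpoints lie in two distinct clusters both reaching `∂ⁱⁿL`
(bond analogue of Cerf's `H = ⋃_{C₁ ≠ C₂ ∈ 𝒞} ∂ᵒᵘᵗC₁ ∩ ∂ᵒᵘᵗC₂ ∩ Λ(n)`, §3; these are the
"two-arms edges"). [cite: Cerf2015, §3] -/
def Hset (L Λ : Finset V) (ω : BondConfig V) : Finset (Sym2 V) :=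
  (edgesIn G Λ).filter fun e => ∀ u v, e = s(u, v) →
    Reaches G L ω u ∧ Reaches G L ω v ∧ v ∉ openClusterIn (withinGraph G ↑L) ω u

/-- **Cerf's statistic** of a finite edge set `A`: `h(A) = #{e ∈ A closed}/(1−p) − #{e ∈ A open}/p`
(Cerf 2015, §3 p. 6, for sites). [cite: Cerf2015, §3] -/
def hstat (p : ℝ) (A : Finset (Sym2 V)) (ω : BondConfig V) : ℝ :=
  ((A.filter fun e => e ∉ ω).card : ℝ) / (1 - p) - ((A.filter fun e => e ∈ ω).card : ℝ) / p

variable {G}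

/-! ## Basic properties of the clusters -/

omit [DecidableEq V] [G.LocallyFinite] in
/-- Membership in `clus`. [folklore] -/
theorem mem_clus {L : Finset V} {ω : BondConfig V} {x y : V} :
    y ∈ clus G L ω x ↔ y ∈ L ∧ y ∈ openClusterIn (withinGraph G ↑L) ω x := by
  simp [clus]

omit [DecidableEq V] [G.LocallyFinite] in
/-- For `x ∈ L` the whole cluster lies in `L`, so `clus` is the cluster. [folklore] -/
theorem mem_clus_of_mem {L : Finset V} {ω : BondConfig V} {x y : V} (hx : x ∈ L)
    (hy : y ∈ openClusterIn (withinGraph G ↑L) ω x) : y ∈ clus G L ω x :=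
  mem_clus.2 ⟨Finset.mem_coe.1 (openClusterIn_withinGraph_subset (Finset.mem_coe.2 hx) ω hy), hy⟩

omit [DecidableEq V] [G.LocallyFinite] in
/-- Vertices of the same cluster have the same `clus`. [folklore] -/
theorem clus_eq_of_mem {L : Finset V} {ω : BondConfig V} {x y : V}
    (hy : y ∈ openClusterIn (withinGraph G ↑L) ω x) : clus G L ω y = clus G L ω x := by
  ext z
  rw [mem_clus, mem_clus, openClusterIn_eq_of_mem hy]

omit [DecidableEq V] [G.LocallyFinite] in
/-- `clus x = clus u` iff `u` lies in the cluster of `x` (`u ∈ L`). [folklore] -/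
theorem clus_eq_iff {L : Finset V} {ω : BondConfig V} {x u : V} (hu : u ∈ L) :
    clus G L ω x = clus G L ω u ↔ u ∈ openClusterIn (withinGraph G ↑L) ω x := by
  constructor
  · intro h
    have : u ∈ clus G L ω u := mem_clus.2 ⟨hu, self_mem_openClusterIn _ _ _⟩
    rw [← h] at this
    exact (mem_clus.1 this).2
  · intro h; exact (clus_eq_of_mem h).symm

/-- Vertices of the same cluster reach `∂ⁱⁿL` together. [folklore] -/
theorem reaches_iff_of_mem {L : Finset V} {ω : BondConfig V} {x y : V}
    (hy : y ∈ openClusterIn (withinGraph G ↑L) ω x) : Reaches G L ω y ↔ Reaches G L ω x := by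
  simp only [Reaches, openClusterIn_eq_of_mem hy]

/-- Membership in `𝒞`. [cite: Cerf2015, §2] -/
theorem mem_bigClusters_iff {L Λ : Finset V} {ω : BondConfig V} {C : Finset V} :
    C ∈ bigClusters G L Λ ω ↔ ∃ x ∈ Λ, Reaches G L ω x ∧ clus G L ω x = C := by
  simp only [bigClusters, Finset.mem_image, Finset.mem_filter]
  constructor
  · rintro ⟨x, ⟨hx, hr⟩, hC⟩; exact ⟨x, hx, hr, hC⟩
  · rintro ⟨x, hx, hr, hC⟩; exact ⟨x, ⟨hx, hr⟩, hC⟩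

/-- For `u ∈ Λ ⊆ L`: `clus u ∈ 𝒞` iff the cluster of `u` reaches `∂ⁱⁿL`. [cite: Cerf2015, §2] -/
theorem clus_mem_bigClusters_iff {L Λ : Finset V} (hΛL : Λ ⊆ L) {ω : BondConfig V} {u : V}
    (hu : u ∈ Λ) : clus G L ω u ∈ bigClusters G L Λ ω ↔ Reaches G L ω u := by
  rw [mem_bigClusters_iff]
  constructor
  · rintro ⟨x, -, hr, hC⟩
    have hux : u ∈ openClusterIn (withinGraph G ↑L) ω x := (clus_eq_iff (hΛL hu)).1 hC
    exact (reaches_iff_of_mem hux).2 hr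
  · intro hr; exact ⟨u, hu, hr, rfl⟩

/-! ## Which clusters of `𝒞` touch a given edge -/

omit [DecidableEq V] [G.LocallyFinite] in
/-- An edge inside `Λ` touches the cluster `clus x` iff one of its endpoints lies in the cluster of
`x` (`Λ ⊆ L`). [folklore] -/
theorem touches_clus_iff {L Λ : Finset V} (hΛL : Λ ⊆ L) {ω : BondConfig V} {x u v : V}
    (hu : u ∈ Λ) (hv : v ∈ Λ) :
    (∃ w ∈ clus G L ω x, w ∈ s(u, v)) ↔
      u ∈ openClusterIn (withinGraph G ↑L) ω x ∨ v ∈ openClusterIn (withinGraph G ↑L) ω x := by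
  constructor
  · rintro ⟨w, hw, hwe⟩
    rw [Sym2.mem_iff] at hwe
    rcases hwe with rfl | rfl
    · exact Or.inl (mem_clus.1 hw).2
    · exact Or.inr (mem_clus.1 hw).2
  · rintro (h | h)
    · exact ⟨u, mem_clus.2 ⟨hΛL hu, h⟩, Sym2.mem_mk_left _ _⟩
    · exact ⟨v, mem_clus.2 ⟨hΛL hv, h⟩, Sym2.mem_mk_right _ _⟩

/-- **The clusters of `𝒞` touching the edge `s(u,v)`** are `clus u` (if it reaches `∂ⁱⁿL`) and
`clus v` (if it reaches `∂ⁱⁿL`). [cite: Cerf2015, §3 (a site belongs to at most 2d sets C̄)] -/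
theorem filter_touches_eq {L Λ : Finset V} (hΛL : Λ ⊆ L) {ω : BondConfig V} {u v : V}
    (hu : u ∈ Λ) (hv : v ∈ Λ) :
    (bigClusters G L Λ ω).filter (fun C => ∃ w ∈ C, w ∈ s(u, v)) =
      (if Reaches G L ω u then {clus G L ω u} else ∅) ∪
        (if Reaches G L ω v then {clus G L ω v} else ∅) := by
  ext C
  simp only [Finset.mem_filter, Finset.mem_union]
  constructor
  · rintro ⟨hC, htouch⟩
    obtain ⟨x, hx, hr, rfl⟩ := mem_bigClusters_iff.1 hC
    rcases (touches_clus_iff hΛL hu hv).1 htouch with h | h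
    · left
      have hru : Reaches G L ω u := (reaches_iff_of_mem h).2 hr
      rw [if_pos hru, Finset.mem_singleton]
      exact (clus_eq_of_mem h).symm
    · right
      have hrv : Reaches G L ω v := (reaches_iff_of_mem h).2 hr
      rw [if_pos hrv, Finset.mem_singleton]
      exact (clus_eq_of_mem h).symm
  · intro h
    rcases h with h | h
    · by_cases hru : Reaches G L ω u
      · rw [if_pos hru, Finset.mem_singleton] at h
        subst h
        exact ⟨(clus_mem_bigClusters_iff hΛL hu).2 hru,
          ⟨u, mem_clus.2 ⟨hΛL hu, self_mem_openClusterIn _ _ _⟩, Sym2.mem_mk_left _ _⟩⟩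
      · rw [if_neg hru] at h; exact absurd h (Finset.notMem_empty _)
    · by_cases hrv : Reaches G L ω v
      · rw [if_pos hrv, Finset.mem_singleton] at h
        subst h
        exact ⟨(clus_mem_bigClusters_iff hΛL hv).2 hrv,
          ⟨v, mem_clus.2 ⟨hΛL hv, self_mem_openClusterIn _ _ _⟩, Sym2.mem_mk_right _ _⟩⟩
      · rw [if_neg hrv] at h; exact absurd h (Finset.notMem_empty _)

/-- The number of clusters of `𝒞` touching `s(u,v)`: `0`, `1` or `2`, namely
`[u reaches] + [v reaches] − [both reach and lie in the same cluster]`. [cite: Cerf2015, §3] -/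
theorem card_filter_touches {L Λ : Finset V} (hΛL : Λ ⊆ L) {ω : BondConfig V} {u v : V}
    (hu : u ∈ Λ) (hv : v ∈ Λ) :
    ((bigClusters G L Λ ω).filter (fun C => ∃ w ∈ C, w ∈ s(u, v))).card =
      (if Reaches G L ω u then 1 else 0) + (if Reaches G L ω v then 1 else 0) -
        (if Reaches G L ω u ∧ Reaches G L ω v ∧ v ∈ openClusterIn (withinGraph G ↑L) ω u then 1 else 0) := by
  rw [filter_touches_eq hΛL hu hv]
  by_cases hru : Reaches G L ω u <;> by_cases hrv : Reaches G L ω v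
  · by_cases hvu : v ∈ openClusterIn (withinGraph G ↑L) ω u
    · have heq : clus G L ω v = clus G L ω u := clus_eq_of_mem hvu
      simp only [hru, hrv, hvu, if_true, and_self, heq, Finset.union_idempotent, Finset.card_singleton,
        Nat.add_sub_cancel]
    · have hne : clus G L ω u ≠ clus G L ω v := fun h => hvu ((clus_eq_iff (hΛL hv)).1 h)
      have hdisj : Disjoint ({clus G L ω u} : Finset (Finset V)) {clus G L ω v} :=
        Finset.disjoint_singleton.2 hne
      simp only [hru, hrv, hvu, if_true, and_false, if_false, Nat.sub_zero,
        Finset.card_union_of_disjoint hdisj, Finset.card_singleton]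
  · simp only [hru, hrv, if_true, if_false, false_and, and_false, Finset.union_empty, Finset.card_singleton,
      Nat.add_zero, Nat.sub_zero]
  · simp only [hru, hrv, if_true, if_false, false_and, Finset.empty_union, Finset.card_singleton,
      Nat.zero_add, Nat.sub_zero]
  · simp only [hru, hrv, if_false, false_and, Finset.union_empty, Finset.card_empty, Nat.sub_zero]

/-! ## Double counting -/

/-- **Double counting**: summing over `𝒞` the number of edges of `touchIn Λ C` with a property `P`
equals summing over the edges inside `Λ` with `P` the number of clusters of `𝒞` they touch.
[cite: Cerf2015, §3] -/
theorem sum_card_touchIn_filter (L Λ : Finset V) (ω : BondConfig V) (P : Sym2 V → Prop) [DecidablePred P] :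
    ∑ C ∈ bigClusters G L Λ ω, ((touchIn G Λ C).filter P).card =
      ∑ e ∈ (edgesIn G Λ).filter P, ((bigClusters G L Λ ω).filter (fun C => ∃ w ∈ C, w ∈ e)).card := by
  simp only [Finset.card_eq_sum_ones, Finset.sum_filter, touchIn]
  rw [Finset.sum_comm]
  refine Finset.sum_congr rfl fun e _ => ?_
  by_cases hP : P e <;> simp [hP]

/-- Edges inside `Λ` are `s(u,v)` with `u ≠ v`, `u, v ∈ Λ`, `G.Adj u v`. [folklore] -/
theorem exists_eq_of_mem_edgesIn {Λ : Finset V} {e : Sym2 V} (he : e ∈ edgesIn G Λ) :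
    ∃ u v, e = s(u, v) ∧ G.Adj u v ∧ u ∈ Λ ∧ v ∈ Λ := by
  rw [mem_edgesIn_iff] at he
  obtain ⟨hE, hΛ⟩ := he
  induction e using Sym2.ind with
  | _ u v =>
    exact ⟨u, v, rfl, (SimpleGraph.mem_edgeSet G).1 hE, hΛ u (Sym2.mem_mk_left _ _), hΛ v (Sym2.mem_mk_right _ _)⟩

omit [DecidableEq V] [G.LocallyFinite] in
/-- An open edge inside `Λ ⊆ L` joins its endpoints inside `L`. [folklore] -/
theorem mem_openClusterIn_of_open {L Λ : Finset V} (hΛL : Λ ⊆ L) {ω : BondConfig V} {u v : V}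
    (hadj : G.Adj u v) (hu : u ∈ Λ) (hv : v ∈ Λ) (hopen : s(u, v) ∈ ω) :
    v ∈ openClusterIn (withinGraph G ↑L) ω u :=
  mem_openClusterIn_of_adj (self_mem_openClusterIn _ _ _)
    (withinGraph_adj.2 ⟨hadj, Finset.mem_coe.2 (hΛL hu), Finset.mem_coe.2 (hΛL hv)⟩) hopen

/-- Membership of `s(u,v)` in `H`. [cite: Cerf2015, §3] -/
theorem mk_mem_Hset_iff {L Λ : Finset V} {ω : BondConfig V} {u v : V} (he : s(u, v) ∈ edgesIn G Λ) :
    s(u, v) ∈ Hset G L Λ ω ↔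
      Reaches G L ω u ∧ Reaches G L ω v ∧ v ∉ openClusterIn (withinGraph G ↑L) ω u := by
  simp only [Hset, Finset.mem_filter, he, true_and]
  constructor
  · intro h; exact h u v rfl
  · rintro ⟨hru, hrv, hvu⟩ u' v' h'
    rw [Sym2.eq_iff] at h'
    rcases h' with ⟨h1, h2⟩ | ⟨h1, h2⟩
    · subst h1; subst h2; exact ⟨hru, hrv, hvu⟩
    · subst h1; subst h2
      refine ⟨hrv, hru, fun h => hvu ?_⟩
      rw [mem_openClusterIn_iff] at h ⊢
      exact h.symm

/-- **The closed count is `|G| + |H|`** (bond version of Cerf's `|H| ≤ Σ_C |∂ᵒᵘᵗC ∩ Λ(n)| − |G|`,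
here an identity: a closed edge inside `Λ` touches `0`, `1` or `2` clusters of `𝒞`, and `2` exactly
when it lies in `H`). Requires `Λ ⊆ L`. [cite: Cerf2015, §3] -/
theorem sum_card_touchIn_closed {L Λ : Finset V} (hΛL : Λ ⊆ L) (ω : BondConfig V) :
    ∑ C ∈ bigClusters G L Λ ω, ((touchIn G Λ C).filter fun e => e ∉ ω).card =
      (Gset G L Λ ω).card + (Hset G L Λ ω).card := by
  rw [sum_card_touchIn_filter]
  -- `|G| + |H|` as a sum over the closed edges inside `Λ`
  have hG : (Gset G L Λ ω).card = ∑ e ∈ (edgesIn G Λ).filter (fun e => e ∉ ω),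
      (if ∃ v, v ∈ e ∧ Reaches G L ω v then 1 else 0) := by
    rw [Gset, Finset.card_eq_sum_ones, Finset.sum_filter, Finset.sum_filter]
    refine Finset.sum_congr rfl fun e _ => ?_
    by_cases h1 : e ∉ ω <;> by_cases h2 : ∃ v, v ∈ e ∧ Reaches G L ω v <;> simp [h1, h2]
  have hH : (Hset G L Λ ω).card = ∑ e ∈ (edgesIn G Λ).filter (fun e => e ∉ ω),
      (if e ∈ Hset G L Λ ω then 1 else 0) := by
    have hsub : Hset G L Λ ω = ((edgesIn G Λ).filter fun e => e ∉ ω).filter (fun e => e ∈ Hset G L Λ ω) := by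
      ext e
      simp only [Finset.mem_filter]
      constructor
      · intro h
        have he : e ∈ edgesIn G Λ := (Finset.mem_filter.1 h).1
        refine ⟨⟨he, ?_⟩, h⟩
        obtain ⟨u, v, rfl, hadj, hu, hv⟩ := exists_eq_of_mem_edgesIn he
        intro hopen
        exact ((mk_mem_Hset_iff he).1 h).2.2 (mem_openClusterIn_of_open hΛL hadj hu hv hopen)
      · intro h; exact h.2
    rw [← Finset.sum_filter, ← hsub, Finset.card_eq_sum_ones]
  rw [hG, hH, ← Finset.sum_add_distrib]
  refine Finset.sum_congr rfl fun e he => ?_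
  rw [Finset.mem_filter] at he
  obtain ⟨he, hclosed⟩ := he
  obtain ⟨u, v, rfl, hadj, hu, hv⟩ := exists_eq_of_mem_edgesIn he
  rw [card_filter_touches hΛL hu hv]
  have hex : (∃ w, w ∈ s(u, v) ∧ Reaches G L ω w) ↔ Reaches G L ω u ∨ Reaches G L ω v := by
    constructor
    · rintro ⟨w, hw, hr⟩
      rcases Sym2.mem_iff.1 hw with rfl | rfl
      · exact Or.inl hr
      · exact Or.inr hr
    · rintro (h | h)
      · exact ⟨u, Sym2.mem_mk_left _ _, h⟩
      · exact ⟨v, Sym2.mem_mk_right _ _, h⟩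
  simp only [mk_mem_Hset_iff he, hex]
  by_cases hru : Reaches G L ω u <;> by_cases hrv : Reaches G L ω v <;>
    by_cases hvu : v ∈ openClusterIn (withinGraph G ↑L) ω u <;> simp [hru, hrv, hvu]

/-- **The open count is `|F|`**: an open edge inside `Λ ⊆ L` has both endpoints in one cluster, which
belongs to `𝒞` iff the edge belongs to `F`. [cite: Cerf2015, §3] -/
theorem sum_card_touchIn_open {L Λ : Finset V} (hΛL : Λ ⊆ L) (ω : BondConfig V) :
    ∑ C ∈ bigClusters G L Λ ω, ((touchIn G Λ C).filter fun e => e ∈ ω).card = (Fset G L Λ ω).card := by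
  rw [sum_card_touchIn_filter]
  have hF : (Fset G L Λ ω).card = ∑ e ∈ (edgesIn G Λ).filter (fun e => e ∈ ω),
      (if ∃ v, v ∈ e ∧ Reaches G L ω v then 1 else 0) := by
    rw [Fset, Finset.card_eq_sum_ones, Finset.sum_filter, Finset.sum_filter]
    refine Finset.sum_congr rfl fun e _ => ?_
    by_cases h1 : e ∈ ω <;> by_cases h2 : ∃ v, v ∈ e ∧ Reaches G L ω v <;> simp [h1, h2]
  rw [hF]
  refine Finset.sum_congr rfl fun e he => ?_
  rw [Finset.mem_filter] at he
  obtain ⟨he, hopen⟩ := he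
  obtain ⟨u, v, rfl, hadj, hu, hv⟩ := exists_eq_of_mem_edgesIn he
  rw [card_filter_touches hΛL hu hv]
  have hvu : v ∈ openClusterIn (withinGraph G ↑L) ω u := mem_openClusterIn_of_open hΛL hadj hu hv hopen
  have hiff : Reaches G L ω v ↔ Reaches G L ω u := reaches_iff_of_mem hvu
  have hex : (∃ w, w ∈ s(u, v) ∧ Reaches G L ω w) ↔ Reaches G L ω u := by
    constructor
    · rintro ⟨w, hw, hr⟩
      rcases Sym2.mem_iff.1 hw with rfl | rfl
      · exact hr
      · exact hiff.1 hr
    · intro h; exact ⟨u, Sym2.mem_mk_left _ _, h⟩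
  simp only [hex]
  by_cases hru : Reaches G L ω u
  · have hrv : Reaches G L ω v := hiff.2 hru
    simp [hru, hrv, hvu]
  · have hrv : ¬ Reaches G L ω v := fun h => hru (hiff.1 h)
    simp [hru, hrv]

/-- **Each edge touches at most two clusters**: `Σ_{C ∈ 𝒞} |touchIn Λ C| ≤ 2 |edgesIn G Λ|`
(bond version of Cerf 2015, §5: "a site belongs to at most `2d` sets of the collection `{C̄}`").
[cite: Cerf2015, §5] -/
theorem sum_card_touchIn_le {L Λ : Finset V} (hΛL : Λ ⊆ L) (ω : BondConfig V) :
    ∑ C ∈ bigClusters G L Λ ω, (touchIn G Λ C).card ≤ 2 * (edgesIn G Λ).card := by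
  have h := sum_card_touchIn_filter (G := G) L Λ ω (fun _ => True)
  simp only [Finset.filter_true] at h
  rw [h]
  calc ∑ e ∈ edgesIn G Λ, ((bigClusters G L Λ ω).filter (fun C => ∃ w ∈ C, w ∈ e)).card
      ≤ ∑ _e ∈ edgesIn G Λ, 2 := by
        refine Finset.sum_le_sum fun e he => ?_
        obtain ⟨u, v, rfl, -, hu, hv⟩ := exists_eq_of_mem_edgesIn he
        rw [card_filter_touches hΛL hu hv]
        split_ifs <;> omega
    _ = 2 * (edgesIn G Λ).card := by rw [Finset.sum_const, smul_eq_mul, mul_comm]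

/-- **`|𝒞| ≤ |∂ⁱⁿL|`** (Cerf 2015, §5: "different clusters of `𝒞` intersect `∂ⁱⁿΛ` at different
sites"): distinct members of `𝒞` are disjoint and each contains a vertex of `∂ⁱⁿL`. [cite: Cerf2015, §5] -/
theorem card_bigClusters_le (L Λ : Finset V) (ω : BondConfig V) :
    (bigClusters G L Λ ω).card ≤ (innerBoundary G L).card := by
  -- choose a boundary vertex in each member
  have hex : ∀ C ∈ bigClusters G L Λ ω, ∃ w ∈ innerBoundary G L, w ∈ C := by
    intro C hC
    obtain ⟨x, hx, ⟨w, hw, hwx⟩, rfl⟩ := mem_bigClusters_iff.1 hC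
    exact ⟨w, hw, mem_clus.2 ⟨(mem_innerBoundary_iff.1 hw).1, hwx⟩⟩
  rcases (bigClusters G L Λ ω).eq_empty_or_nonempty with h0 | ⟨C₀, hC₀⟩
  · rw [h0, Finset.card_empty]; exact Nat.zero_le _
  haveI : Nonempty V := ⟨(hex C₀ hC₀).choose⟩
  choose! f hf using hex
  refine Finset.card_le_card_of_injOn f (fun C hC => (hf C hC).1) ?_
  intro C hC C' hC' hff
  have hC₁ : C ∈ bigClusters G L Λ ω := Finset.mem_coe.1 hC
  have hC₂ : C' ∈ bigClusters G L Λ ω := Finset.mem_coe.1 hC'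
  obtain ⟨x, -, -, hCx⟩ := mem_bigClusters_iff.1 hC₁
  obtain ⟨x', -, -, hCx'⟩ := mem_bigClusters_iff.1 hC₂
  have h1 : f C ∈ openClusterIn (withinGraph G ↑L) ω x := by
    have hmem : f C ∈ clus G L ω x := by rw [hCx]; exact (hf C hC₁).2
    exact (mem_clus.1 hmem).2
  have h2 : f C' ∈ openClusterIn (withinGraph G ↑L) ω x' := by
    have hmem : f C' ∈ clus G L ω x' := by rw [hCx']; exact (hf C' hC₂).2
    exact (mem_clus.1 hmem).2
  calc C = clus G L ω x := hCx.symm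
    _ = clus G L ω (f C) := (clus_eq_of_mem h1).symm
    _ = clus G L ω (f C') := by rw [hff]
    _ = clus G L ω x' := clus_eq_of_mem h2
    _ = C' := hCx'

/-- **The pointwise identity of §3, bond version**:
`|H| = (1−p) Σ_{C ∈ 𝒞} h(touchIn Λ C) + ((1−p)/p) |F| − |G|` for `0 < p < 1`.
[cite: Cerf2015, §3 (E|H| ≤ (1−p) E Σ_C h(C̄ ∩ Λ(n)))] -/
theorem card_H_eq {L Λ : Finset V} (hΛL : Λ ⊆ L) (ω : BondConfig V) {p : ℝ} (hp0 : p ≠ 0) (hp1 : 1 - p ≠ 0) :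
    ((Hset G L Λ ω).card : ℝ) =
      (1 - p) * ∑ C ∈ bigClusters G L Λ ω, hstat p (touchIn G Λ C) ω +
        (1 - p) / p * (Fset G L Λ ω).card - (Gset G L Λ ω).card := by
  have h1 := sum_card_touchIn_closed (G := G) hΛL ω
  have h2 := sum_card_touchIn_open (G := G) hΛL ω
  have h1' : (∑ C ∈ bigClusters G L Λ ω, (((touchIn G Λ C).filter fun e => e ∉ ω).card : ℝ)) =
      (Gset G L Λ ω).card + (Hset G L Λ ω).card := by exact_mod_cast h1
  have h2' : (∑ C ∈ bigClusters G L Λ ω, (((touchIn G Λ C).filter fun e => e ∈ ω).card : ℝ)) =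
      (Fset G L Λ ω).card := by exact_mod_cast h2
  simp only [hstat, Finset.sum_sub_distrib, ← Finset.sum_div]
  rw [h1', h2']
  field_simp
  ring

end AKN

end Literature.Probability.Percolation

end
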